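import Summits.NavierStokesRegularity.NavierStokesRegularity.Theorems.FluidComputerCalibrationPump
import Summits.NavierStokesRegularity.NavierStokesRegularity.Theorems.FluidComputerRobust
import Literature.Analysis.FluidPDE.FluidComputer.OneShot
import HarnessLib

/-!
# Fluid computer blueprint — ONE-SHOT DEGENERACY of the interfaces, and the LIVE cascade

HONEST FRAMING: low prior, high value-of-information experiment on Tao's machine paradigm; NOT a
claim that NS blows up. Nothing here constructs a cascade; every existence statement below has a
blow-up hypothesis. This file MEASURES the interfaces `CascadeWitness`, `PumpCascade`,
`RobustPumpCascade` (`Literature.Analysis.FluidPDE.FluidComputer`) against the degenerate ONE-SHOT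
inhabitants of `…FluidComputer.OneShot`, and proves the cascade proper — energy `≥ E₀ηⁿ` at
frequencies `≥ λ₀2ⁿ` for EVERY `n`, at times `t_n ≤ ∑_{k<n} T_k < T_*`, along the seed's maximal
mild Navier–Stokes trajectory — from the LIVENESS hypothesis `PumpCascade.Live`.

## Results

* `doomed_iff_lifespan_le`: on `H¹⁰_df` states, `Doomed T v` ("no mild trajectory is alive `T`
  after visiting `v`") ⟺ `0 ≤ T` ∧ every mild solution FROM `v` has lifespan `≤ T` (`timeShift`).
* `exists_cascadeWitness_iff_lifespan_le` — EXACT CALIBRATION of `CascadeWitness` (closing the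
  residual gap of `FluidComputerCalibration.lean`; no Leray rate, no `H¹`-versus-`H¹⁰` issue):
  `(∃ W : CascadeWitness, W.u₀ = u₀ ∧ W.Tstar ≤ τ) ↔ (every mild lifespan from u₀ is ≤ τ)`.
  The backward witness is ONE-SHOT (stage `0 = {u₀}` with allowance `τ`, later stages empty):
  `fires` only speaks of trajectories still alive at `t + T_n`, and there are none.
* `exists_pumpCascade_of_lifespan_le` / `floor_and_lifespan_of_pumpCascade` — the SANDWICH for a
  FIXED spec sheet `S`: (floor `E₀` at `|ξ| ≥ λ₀` on `u₀`) ∧ (lifespans `≤ T_0 = Cλ₀^{-α}`) ⟹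
  `∃ PumpCascade S` seeded at `u₀` ⟹ (`α > 0`, `η > 1/4`) the same floor ∧ (lifespans
  `≤ T_* = T_0/(1 - 2^{-α})`, `tmax_zero_eq_mul_tstar`). The cascade produced is one-shot (all
  output classes empty, later generations idle) and NOT live;
  `exists_robustPumpCascade_of_stableLifespan` is the same for the robust interface (floors and
  lifespans `≤ T_0` on the `H¹⁰_df` part of the `X^s_{λ₀}`-ball of radius `ρ√E₀` about `u₀`;
  forward in the tree: `stableBlowup_of_robustPumpCascade`). So AS TYPED the three interfaces
  encode (stable) finite-time blow-up and nothing else — no transfer to finer scales is forced.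
* `allGenerationsFire` — THE CASCADE AS A THEOREM under liveness (`α > 0`, `η > 1/4`): the seed's
  maximal mild trajectory `U` on `[0, S_m)` (`S_m ≤ T_*`, no mild extension, unbounded `H¹⁰` norm)
  carries a clock `0 = t_0 ≤ t_1 ≤ …`, `t_n < S_m`, `t_{n+1} - t_n ≤ (G n).T ≤ Cλ_n^{-α}`, with
  `U t_n ∈ In n` for EVERY `n` (`Completes` at `U t_n` + gluing `stub_restart` + maximality ⇒
  `t_n + T_n < S_m` ⇒ `fires` ⇒ `replicate`); `energy_reaches_all_scales`:
  `E₀ηⁿ ≤ ∫_{|ξ| ≥ λ₀2ⁿ} |Û(t_n)|²` with `t_n ≤ ∑_{k<n} Cλ_k^{-α}`, for every `n`.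
* `exists_livePumpCascade_of_clockedInstants`, `live_calibration` — the honest converse: a mild
  trajectory from `u₀` meeting the clocked floors at monotone instants `t_n < S_m`,
  `t_{n+1} - t_n ≤ Cλ_n^{-α}`, IS a live pump cascade (point classes `In n = {U t_n}`,
  `Out n = {U t_{n+1}}`; `Completes` because `t_{n+1} < S_m`). So
  `(∃ live PumpCascade S seeded at u₀) ↔ (∃ such a clocked orbit)`: even the live interface types a
  CLOCKED DYADIC BLOW-UP PROFILE AT INSTANTS, not a machine; gates, wiring, self-replication and
  shadowing live entirely in CONSTRUCTING such an orbit (blueprint `ASSEMBLY.md` §2e–§2f).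

## References

* T. Tao, *Finite time blowup for an averaged three-dimensional Navier–Stokes equation*, J. Amer.
  Math. Soc. 29 (2016) 601–674, arXiv:1402.0290v3, §1.3 pp. 10–11 (the machine programme), §6
  Prop. 6.3 (existence up to each checkpoint time `t_n`). [Tao2016AveragedNS]
-/

set_option linter.dupNamespace false

noncomputable section

open Set Filter Topology
open scoped SchwartzMap ENNReal BigOperators

namespace Summit.NavierStokesRegularity.NavierStokesRegularity.Theorems.FluidComputer

open Literature.Analysis.FluidPDE Literature.Analysis.FluidPDE.Tao2016
open Literature.Analysis.FluidPDE.FluidComputer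
open Literature.Analysis.FunctionSpaces (eFourierSobolevNorm)
open Literature.Barriers.NavierStokesRegularity.AveragedTypeI (euler_form_eq)

/-! ### §1. Doomed states = bounded lifespan -/

/-- A state all of whose own mild Navier–Stokes solutions have lifespan `≤ T` (`T ≥ 0`) is
`Doomed T`: a trajectory visiting `v` at time `t` and alive on `[0,S)` restarts, by time
translation, as a mild solution FROM `v` on `[0, S - t)`. -/
theorem doomed_of_lifespan_le {T : ℝ} {v : L2C} (hT : 0 ≤ T)
    (h : ∀ (S : ℝ) (u : ℝ → L2C), IsMildSolutionFor eulerForm v (Ico 0 S) u → S ≤ T) :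
    Doomed T v := by
  intro a S u hu t ht htv
  by_cases htS : t < S
  · have hs : IsMildSolutionFor AveragingDatum.euler.form (u t) (Ico 0 (S - t))
        (fun s => u (t + s)) := by
      refine timeShift AveragingDatum.euler (a := a) ?_ ht
      rwa [euler_form_eq]
    rw [euler_form_eq, htv] at hs
    linarith [h (S - t) _ hs]
  · linarith [not_lt.1 htS]

/-- **Doomed = bounded lifespan** on `H¹⁰_df` states: `Doomed T v ↔ 0 ≤ T ∧` every
`H¹⁰_df`-mild Navier–Stokes solution from `v` on `[0,S)` has `S ≤ T`. -/
theorem doomed_iff_lifespan_le {T : ℝ} {v : L2C} (h10 : MemH10df v) :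
    Doomed T v ↔
      0 ≤ T ∧ ∀ (S : ℝ) (u : ℝ → L2C), IsMildSolutionFor eulerForm v (Ico 0 S) u → S ≤ T :=
  ⟨fun hv => ⟨hv.nonneg, fun _ _ hu => hv.lifespan_le h10 hu⟩,
    fun h => doomed_of_lifespan_le h.1 h.2⟩

/-! ### §2. Exact calibration of `CascadeWitness` -/

/-- **EXACT CALIBRATION of the cascade-witness interface.** For a Schwartz divergence-free datum
`u₀` and any `τ`: there is a `CascadeWitness` with datum `u₀` and total allowance `T_* ≤ τ` IF AND
ONLY IF every `H¹⁰_df`-mild Navier–Stokes solution from `u₀` has lifespan `≤ τ`. Forward: Theorem A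
(`CascadeWitness.lifespan_le`). Backward: the ONE-SHOT witness `CascadeWitness.oneShot` (stage
`0 = {u₀}` with allowance `τ`, all later stages empty). No residual gap: the interface types
finite-time blow-up of the datum and nothing else. HONEST FRAMING: an equivalence between two
statements nobody knows to be inhabited; NOT a claim that NS blows up. -/
theorem exists_cascadeWitness_iff_lifespan_le
    (u₀ : 𝓢(EuclideanSpace ℝ (Fin 3), EuclideanSpace ℝ (Fin 3)))
    (hdiv : VectorCalculus.IsDivFree ⇑u₀) (τ : ℝ) :
    (∃ W : CascadeWitness, W.u₀ = u₀ ∧ W.Tstar ≤ τ) ↔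
      ∀ (S : ℝ) (u : ℝ → L2C),
        IsMildSolutionFor eulerForm (schwartzL2 u₀) (Ico 0 S) u → S ≤ τ := by
  constructor
  · rintro ⟨W, rfl, hW⟩ S u hu
    exact (W.lifespan_le hu).trans hW
  · intro h
    have hτ : 0 ≤ τ := h 0 (fun _ => 0) (isMildSolutionFor_Ico_of_nonpos _ _ le_rfl _)
    have h10 : MemH10df (schwartzL2 u₀) := PumpContinuationSchwartzData.memH10df_schwartzL2 u₀ hdiv
    exact ⟨CascadeWitness.oneShot u₀ hdiv h10 τ hτ h, rfl,
      (CascadeWitness.oneShot_Tstar u₀ hdiv h10 τ hτ h).le⟩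

/-! ### §3. The sandwich for `PumpCascade S` and `RobustPumpCascade S s ρ` -/

/-- The energy floor of generation `n` on its input class, in spec-sheet terms:
`E₀ηⁿ ≤ ∫_{|ξ| ≥ λ₀2ⁿ} |v̂|²` for `v ∈ In n`. -/
theorem floor_of_mem {S : CascadeSpecs} (L : PumpCascade S) (n : ℕ) {v : L2C}
    (hv : v ∈ (L.G n).In) : ENNReal.ofReal (S.Emin n) ≤ highFreqEnergy (S.lam n) v := by
  have h := (L.G n).in_floor v hv
  rw [L.scale n] at h
  exact (ENNReal.ofReal_le_ofReal (L.energy n)).trans h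

/-- **One tick versus the whole budget**: `T_0 = Cλ₀^{-α} = (1 - 2^{-α}) T_*` for `α > 0` — the
width of the sandwich below. -/
theorem tmax_zero_eq_mul_tstar (S : CascadeSpecs) (hα : 0 < S.alpha) :
    S.Tmax 0 = (1 - (2 : ℝ) ^ (-S.alpha)) * S.Tstar := by
  have h1 : (1 - (2 : ℝ) ^ (-S.alpha)) ≠ 0 := (sub_pos.2 (CascadeSpecs.two_rpow_neg_lt_one hα)).ne'
  rw [S.Tstar_eq hα, S.Tmax_eq_geometric, pow_zero, mul_one, ← mul_div_assoc,
    mul_div_cancel_left₀ _ h1]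

/-- **Forward half of the sandwich** (in the tree, restated): a pump cascade with `α > 0`,
`η > 1/4` gives the generation-`0` floor on its seed and lifespan `≤ T_*` for every mild
Navier–Stokes trajectory from it. -/
theorem floor_and_lifespan_of_pumpCascade {S : CascadeSpecs} (L : PumpCascade S)
    (hα : 0 < S.alpha) (hη : 1 / 4 < S.eta) :
    ENNReal.ofReal (S.Emin 0) ≤ highFreqEnergy (S.lam 0) (schwartzL2 L.u₀) ∧
      ∀ (S' : ℝ) (u : ℝ → L2C),
        IsMildSolutionFor eulerForm (schwartzL2 L.u₀) (Ico 0 S') u → S' ≤ S.Tstar :=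
  ⟨floor_of_mem L 0 L.ignite, fun _ _ hu => L.lifespan_le hα hη hu⟩

/-- **Backward half of the sandwich (ONE-SHOT DEGENERACY of `PumpCascade`).** For ANY spec sheet
`S`: a Schwartz divergence-free datum carrying the generation-`0` floor (`E₀ ≤ ∫_{|ξ|≥λ₀} |û₀|²`)
all of whose mild Navier–Stokes solutions have lifespan `≤ T_0 = Cλ₀^{-α}` seeds a `PumpCascade S`
— the one-shot library (generation `0`: doomed floor states ↦ `∅`; later generations idle): empty
output classes throughout, NOT live. The interface forces no transfer of energy to finer scales;
gap to the forward half: `T_0` versus `T_* = T_0/(1-2^{-α})`. NOT a claim that NS blows up. -/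
theorem exists_pumpCascade_of_lifespan_le (S : CascadeSpecs)
    (u₀ : 𝓢(EuclideanSpace ℝ (Fin 3), EuclideanSpace ℝ (Fin 3)))
    (hdiv : VectorCalculus.IsDivFree ⇑u₀)
    (hfloor : ENNReal.ofReal (S.Emin 0) ≤ highFreqEnergy (S.lam 0) (schwartzL2 u₀))
    (hlife : ∀ (S' : ℝ) (u : ℝ → L2C),
      IsMildSolutionFor eulerForm (schwartzL2 u₀) (Ico 0 S') u → S' ≤ S.Tmax 0) :
    ∃ L : PumpCascade S, L.u₀ = u₀ ∧ (∀ n, (L.G n).Out = ∅) ∧ ¬ L.Live := by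
  have h10 : MemH10df (schwartzL2 u₀) := PumpContinuationSchwartzData.memH10df_schwartzL2 u₀ hdiv
  have hdoom : Doomed (S.Tmax 0) (schwartzL2 u₀) := doomed_of_lifespan_le (S.Tmax_nonneg 0) hlife
  exact ⟨PumpCascade.oneShot S u₀ hdiv h10 hfloor hdoom, rfl,
    fun n => by simp [PumpCascade.oneShot_G],
    PumpCascade.not_live_oneShot S u₀ hdiv h10 hfloor hdoom⟩

/-- **One-shot degeneracy of the ROBUST interface.** For any `S`, `s`, `ρ`: if the seed carries
the generation-`0` floor with all its mild lifespans `≤ T_0`, and so does every `H¹⁰_df` state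
within `X^s_{λ₀}`-distance `ρ√E₀` of it, then there is a `RobustPumpCascade S s ρ` seeded at `u₀`
(one-shot: output classes empty, so `margin` is vacuous; not live). Forward direction in the tree:
`stableBlowup_of_robustPumpCascade`. The robust interface types STABLE finite-time blow-up and
nothing else. HONEST FRAMING: NOT a claim that NS blows up. -/
theorem exists_robustPumpCascade_of_stableLifespan (S : CascadeSpecs) (s ρ : ℝ)
    (u₀ : 𝓢(EuclideanSpace ℝ (Fin 3), EuclideanSpace ℝ (Fin 3)))
    (hdiv : VectorCalculus.IsDivFree ⇑u₀)
    (hfloor : ENNReal.ofReal (S.Emin 0) ≤ highFreqEnergy (S.lam 0) (schwartzL2 u₀))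
    (hlife : ∀ (S' : ℝ) (u : ℝ → L2C),
      IsMildSolutionFor eulerForm (schwartzL2 u₀) (Ico 0 S') u → S' ≤ S.Tmax 0)
    (hball : ∀ w : L2C, MemH10df w →
      scaledSobolevNorm s (S.lam 0) (w - schwartzL2 u₀) <
          ENNReal.ofReal (ρ * Real.sqrt (S.Emin 0)) →
        ENNReal.ofReal (S.Emin 0) ≤ highFreqEnergy (S.lam 0) w ∧
          ∀ (S' : ℝ) (u : ℝ → L2C), IsMildSolutionFor eulerForm w (Ico 0 S') u → S' ≤ S.Tmax 0) :
    ∃ R : RobustPumpCascade S s ρ, R.u₀ = u₀ ∧ (∀ n, (R.G n).Out = ∅) ∧ ¬ R.toPumpCascade.Live := by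
  have h10 : MemH10df (schwartzL2 u₀) := PumpContinuationSchwartzData.memH10df_schwartzL2 u₀ hdiv
  have hdoom : Doomed (S.Tmax 0) (schwartzL2 u₀) := doomed_of_lifespan_le (S.Tmax_nonneg 0) hlife
  have hball' : ∀ w : L2C, MemH10df w →
      scaledSobolevNorm s (S.lam 0) (w - schwartzL2 u₀) <
          ENNReal.ofReal (ρ * Real.sqrt (S.Emin 0)) →
        ENNReal.ofReal (S.Emin 0) ≤ highFreqEnergy (S.lam 0) w ∧ Doomed (S.Tmax 0) w :=
    fun w hw hlt => ⟨(hball w hw hlt).1, doomed_of_lifespan_le (S.Tmax_nonneg 0) (hball w hw hlt).2⟩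
  exact ⟨RobustPumpCascade.oneShot S s ρ u₀ hdiv h10 hfloor hdoom hball', rfl,
    fun n => by simp [PumpCascade.oneShot_G], by
      simpa using PumpCascade.not_live_oneShot S u₀ hdiv h10 hfloor hdoom⟩

/-! ### §4. The live cascade on the seed's maximal trajectory -/

/-- Telescoping a clock against its ticks: `t 0 = 0`, `t (n+1) - t n ≤ T n` give
`t n ≤ ∑_{k<n} T k`. -/
theorem clock_le_partialSum {T t : ℕ → ℝ} (ht0 : t 0 = 0) (hstep : ∀ n, t (n + 1) - t n ≤ T n)
    (n : ℕ) : t n ≤ ∑ k ∈ Finset.range n, T k := by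
  induction n with
  | zero => simp [ht0]
  | succ n ih =>
    rw [Finset.sum_range_succ]
    linarith [hstep n]

/-- **ALL GENERATIONS FIRE UNDER LIVENESS** (the cascade proper as a theorem; `α > 0`, `η > 1/4`).
For a LIVE pump cascade the seed's MAXIMAL `H¹⁰_df`-mild Navier–Stokes trajectory `U` on `[0, S_m)`
(`S_m ≤ T_*`, no mild extension, unbounded `H¹⁰` norm; in-tree `h10MildTheory_holds`) carries a
clock `t`, `t 0 = 0`, monotone, `t n < S_m`, `t (n+1) - t n ≤ (G n).T`, with `U (t n) ∈ In n` for
EVERY `n`. Step: `Completes` at `U (t n)` gives a mild solution from it outliving the tick; glued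
onto `U` at `t n` (`stub_restart`) it lives on `[0, t n + τ)`, `τ > T_n`, so maximality (via
uniqueness) gives `t n + T_n < S_m`; then `fires` applies to `U` itself and `replicate` loads
generation `n+1` at `t (n+1) ∈ [t n, t n + T_n]`. HONEST FRAMING: an implication from a live pump
cascade, a structure nobody knows to be inhabited; NOT a claim that NS blows up. -/
theorem allGenerationsFire {S : CascadeSpecs} (L : PumpCascade S) (hα : 0 < S.alpha)
    (hη : 1 / 4 < S.eta) (hlive : L.Live) :
    ∃ Sm : ℝ, 0 < Sm ∧ Sm ≤ S.Tstar ∧ ∃ U : ℝ → L2C,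
      IsMildSolutionFor eulerForm (schwartzL2 L.u₀) (Ico 0 Sm) U ∧
      (¬ ∃ S' : ℝ, Sm < S' ∧ ∃ v : ℝ → L2C,
        IsMildSolutionFor eulerForm (schwartzL2 L.u₀) (Ico 0 S') v ∧ ∀ s ∈ Ico 0 Sm, v s = U s) ∧
      (∀ C : ℝ, ∃ s ∈ Ico 0 Sm, ENNReal.ofReal C < eFourierSobolevNorm 10 (U s)) ∧
      ∃ t : ℕ → ℝ, t 0 = 0 ∧ Monotone t ∧ (∀ n, t n < Sm) ∧
        (∀ n, t (n + 1) - t n ≤ (L.G n).T) ∧ ∀ n, U (t n) ∈ (L.G n).In := by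
  obtain ⟨Sm, hSm, hle, U, hU, hmax, hunb⟩ :=
    exists_maximal_unbounded_of_lifespan_le h10MildTheory_holds L.memH10df
      (fun S' u hu => L.lifespan_le hα hη hu)
  refine ⟨Sm, hSm, hle, U, hU, hmax, hunb, ?_⟩
  -- every mild solution from the seed lives at most `S_m` (uniqueness + maximality)
  have hagree : ∀ (S' : ℝ) (u : ℝ → L2C),
      IsMildSolutionFor eulerForm (schwartzL2 L.u₀) (Ico 0 S') u → S' ≤ Sm := by
    intro S' u hu
    by_contra hS
    have hS' : Sm < S' := lt_of_not_ge hS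
    exact hmax ⟨S', hS', u, hu, fun s hs =>
      h10MildTheory_holds.uniqueness _ Sm u U (hu.mono (Ico_subset_Ico_right hS'.le)) hU s hs⟩
  -- ONE STEP on the maximal orbit
  have hstep : ∀ (n : ℕ) (r : ℝ), 0 ≤ r → r < Sm → U r ∈ (L.G n).In →
      ∃ s : ℝ, r ≤ s ∧ s ≤ r + (L.G n).T ∧ s < Sm ∧ U s ∈ (L.G (n + 1)).In := by
    intro n r hr0 hrSm hmem
    obtain ⟨S', hS', w, hw⟩ := hlive n (U r) hmem (hU.1 r ⟨hr0, hrSm⟩)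
    set τ : ℝ := ((L.G n).T + S') / 2 with hτ
    have hτT : (L.G n).T < τ := by rw [hτ]; linarith
    have hτS : τ < S' := by rw [hτ]; linarith
    have hτpos : 0 < τ := (L.G n).T_nonneg.trans_lt hτT
    have hglue := PerpetualPumpThesis.stub_restart AveragingDatum.euler (schwartzL2 L.u₀) Sm r τ U w
      hr0 hrSm hτpos (by rwa [euler_form_eq])
      (by rw [euler_form_eq]; exact hw.mono (Icc_subset_Ico_right hτS))
    rw [euler_form_eq] at hglue
    have hlife : r + τ ≤ Sm := hagree (r + τ) _ hglue
    have hrT : r + (L.G n).T < Sm := by linarith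
    obtain ⟨s, hrs, hsT, hs⟩ := (L.G n).fires (schwartzL2 L.u₀) Sm U hU r hr0 hmem hrT
    exact ⟨s, hrs, hsT, hsT.trans_lt hrT, L.replicate n hs⟩
  choose! f hf using hstep
  -- iterate the step from `t 0 = 0`
  obtain ⟨t, ht0, htsucc⟩ : ∃ t : ℕ → ℝ, t 0 = 0 ∧ ∀ n, t (n + 1) = f n (t n) :=
    ⟨fun n => Nat.rec (motive := fun _ => ℝ) 0 (fun k tk => f k tk) n, rfl, fun _ => rfl⟩
  have hinv : ∀ n, 0 ≤ t n ∧ t n < Sm ∧ U (t n) ∈ (L.G n).In := by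
    intro n
    induction n with
    | zero =>
      rw [ht0, initial_eq hU ⟨le_rfl, hSm⟩ L.memH10df]
      exact ⟨le_rfl, hSm, L.ignite⟩
    | succ n ih =>
      obtain ⟨h0, hlt, hmem⟩ := ih
      obtain ⟨hle', -, hlt', hmem'⟩ := hf n (t n) h0 hlt hmem
      rw [htsucc]
      exact ⟨h0.trans hle', hlt', hmem'⟩
  have hsucc : ∀ n, t n ≤ t (n + 1) ∧ t (n + 1) - t n ≤ (L.G n).T := by
    intro n
    obtain ⟨h0, hlt, hmem⟩ := hinv n
    obtain ⟨hle', hleT, -, -⟩ := hf n (t n) h0 hlt hmem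
    rw [htsucc]
    exact ⟨hle', by linarith⟩
  exact ⟨t, ht0, monotone_nat_of_le_succ fun n => (hsucc n).1, fun n => (hinv n).2.1,
    fun n => (hsucc n).2, fun n => (hinv n).2.2⟩

/-- **ENERGY REACHES ALL SCALES BEFORE `T_*` under liveness** (`α > 0`, `η > 1/4`): along the
seed's maximal mild Navier–Stokes trajectory `U` on `[0,S_m)`, `S_m ≤ T_*`, for EVERY `n` there is a
time `t_n < S_m` with `t_n ≤ ∑_{k<n} Cλ_k^{-α}` at which `E₀ηⁿ ≤ ∫_{|ξ| ≥ λ₀2ⁿ} |Û(t_n)|²`; the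
`t_n` increase from `t_0 = 0`, and `‖U(t)‖_{H¹⁰}` is unbounded on `[0,S_m)`. This is what the
blueprint's task statement calls "energy at arbitrarily fine scales in finite time"; the ONE-SHOT
inhabitants show it is NOT a consequence of `PumpCascade` alone. HONEST FRAMING: NOT a claim that
NS blows up. -/
theorem energy_reaches_all_scales {S : CascadeSpecs} (L : PumpCascade S) (hα : 0 < S.alpha)
    (hη : 1 / 4 < S.eta) (hlive : L.Live) :
    ∃ Sm : ℝ, 0 < Sm ∧ Sm ≤ S.Tstar ∧ ∃ U : ℝ → L2C,
      IsMildSolutionFor eulerForm (schwartzL2 L.u₀) (Ico 0 Sm) U ∧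
      (∀ C : ℝ, ∃ s ∈ Ico 0 Sm, ENNReal.ofReal C < eFourierSobolevNorm 10 (U s)) ∧
      ∃ t : ℕ → ℝ, t 0 = 0 ∧ Monotone t ∧
        ∀ n, t n < Sm ∧ t n ≤ ∑ k ∈ Finset.range n, S.Tmax k ∧
          ENNReal.ofReal (S.Emin n) ≤ highFreqEnergy (S.lam n) (U (t n)) := by
  obtain ⟨Sm, hSm, hle, U, hU, -, hunb, t, ht0, htmono, htlt, htstep, hmem⟩ :=
    allGenerationsFire L hα hη hlive
  exact ⟨Sm, hSm, hle, U, hU, hunb, t, ht0, htmono, fun n => ⟨htlt n,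
    clock_le_partialSum ht0 (fun k => (htstep k).trans (L.time k)) n, floor_of_mem L n (hmem n)⟩⟩

/-! ### §5. The honest converse: the live interface types a clocked orbit -/

/-- **A clocked orbit IS a live pump cascade** (converse calibration of the live interface). An
`H¹⁰_df`-mild Navier–Stokes solution `U` on `[0, S_m)` from a Schwartz divergence-free datum `u₀`
and a clock `t` (`t 0 = 0`, monotone, `t n < S_m`, `t (n+1) - t n ≤ Cλ_n^{-α}`) at whose instants
the spec's floors hold (`E₀ηⁿ ≤ ∫_{|ξ|≥λ_n} |Û(t n)|²`) yield a LIVE `PumpCascade S` seeded at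
`u₀` with POINT classes `In n = {U (t n)}`, `Out n = {U (t (n+1))}`, `T n = t (n+1) - t n`:
`fires` by orbit following (`orbit_follow`), `Completes` because the translate of `U` from `t n`
lives `S_m - t n > T n`. HONEST READING: even with liveness the interface cannot tell a fluid
computer from a single clocked blow-up orbit sampled at instants. -/
theorem exists_livePumpCascade_of_clockedInstants (S : CascadeSpecs)
    (u₀ : 𝓢(EuclideanSpace ℝ (Fin 3), EuclideanSpace ℝ (Fin 3)))
    (hdiv : VectorCalculus.IsDivFree ⇑u₀) {Sm : ℝ} {U : ℝ → L2C}
    (hU : IsMildSolutionFor eulerForm (schwartzL2 u₀) (Ico 0 Sm) U)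
    (t : ℕ → ℝ) (ht0 : t 0 = 0) (htmono : Monotone t) (htlt : ∀ n, t n < Sm)
    (htime : ∀ n, t (n + 1) - t n ≤ S.Tmax n)
    (hfloor : ∀ n, ENNReal.ofReal (S.Emin n) ≤ highFreqEnergy (S.lam n) (U (t n))) :
    ∃ L : PumpCascade S, L.u₀ = u₀ ∧ L.Live ∧
      ∀ n, (L.G n).In = {U (t n)} ∧ (L.G n).Out = {U (t (n + 1))} ∧
        (L.G n).T = t (n + 1) - t n := by
  have h10 : MemH10df (schwartzL2 u₀) := PumpContinuationSchwartzData.memH10df_schwartzL2 u₀ hdiv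
  have hSm : 0 < Sm := by have h := htlt 0; rwa [ht0] at h
  have htnn : ∀ n, 0 ≤ t n := fun n => by have h := htmono (Nat.zero_le n); rwa [ht0] at h
  have hsum : ∀ n, t n + (t (n + 1) - t n) = t (n + 1) := fun n => by ring
  -- context-free firing of the point gadget of generation `n`, by orbit following
  have hfires : ∀ (n : ℕ) (a : L2C) (S' : ℝ) (u : ℝ → L2C),
      IsMildSolutionFor eulerForm a (Ico 0 S') u →
        ∀ r : ℝ, 0 ≤ r → u r ∈ ({U (t n)} : Set L2C) → r + (t (n + 1) - t n) < S' →
          ∃ s : ℝ, r ≤ s ∧ s ≤ r + (t (n + 1) - t n) ∧ u s ∈ ({U (t (n + 1))} : Set L2C) := by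
    intro n a S' u hu r hr0 hur hrS'
    rw [mem_singleton_iff] at hur
    have hδ : 0 ≤ t (n + 1) - t n := sub_nonneg.2 (htmono n.le_succ)
    have heq : u (r + (t (n + 1) - t n)) = U (t n + (t (n + 1) - t n)) :=
      orbit_follow hu hU hr0 (htnn n) hur.symm hδ hrS' (by rw [hsum]; exact htlt (n + 1))
    refine ⟨r + (t (n + 1) - t n), by linarith, le_rfl, ?_⟩
    rw [mem_singleton_iff, heq, hsum]
  let G : ℕ → PumpGadget := fun n =>
    { κ := S.lam n
      κ_nonneg := (S.lam_pos n).le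
      In := {U (t n)}
      Out := {U (t (n + 1))}
      Ein := S.Emin n
      in_floor := fun v hv => by
        rw [mem_singleton_iff] at hv
        rw [hv]; exact hfloor n
      T := t (n + 1) - t n
      T_nonneg := sub_nonneg.2 (htmono n.le_succ)
      fires := hfires n }
  have hGIn : ∀ n, (G n).In = {U (t n)} := fun _ => rfl
  have hGT : ∀ n, (G n).T = t (n + 1) - t n := fun _ => rfl
  refine ⟨{ G := G
            scale := fun _ => rfl
            replicate := fun _ => Subset.rfl
            energy := fun _ => le_rfl
            time := htime
            u₀ := u₀
            divFree := hdiv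
            memH10df := h10
            ignite := by
              rw [hGIn, mem_singleton_iff, ht0, initial_eq hU ⟨le_rfl, hSm⟩ h10] },
    rfl, ?_, fun n => ⟨hGIn n, rfl, hGT n⟩⟩
  -- liveness: the translate of `U` from `t n` outlives the tick
  intro n v hv _
  rw [hGIn, mem_singleton_iff] at hv
  subst hv
  refine ⟨Sm - t n, ?_, fun s => U (t n + s), ?_⟩
  · rw [hGT]; linarith [htlt (n + 1)]
  · have h := timeShift AveragingDatum.euler (a := schwartzL2 u₀) (T := Sm) (t₁ := t n) (u := U)
      (by rwa [euler_form_eq]) (htnn n)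
    rwa [euler_form_eq] at h

/-- **LIVE CALIBRATION** (`α > 0`, `η > 1/4`): a Schwartz divergence-free datum `u₀` seeds a LIVE
`PumpCascade S` if and only if some `H¹⁰_df`-mild Navier–Stokes solution `U` from `u₀` on some
`[0, S_m)` meets the spec's clocked floors at instants: a monotone clock `t`, `t 0 = 0`,
`t n < S_m`, `t (n+1) - t n ≤ Cλ_n^{-α}`, `E₀ηⁿ ≤ ∫_{|ξ|≥λ₀2ⁿ} |Û(t n)|²` for every `n` (and then
every mild trajectory from `u₀` dies by `T_*`, `floor_and_lifespan_of_pumpCascade`). Forward: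
`allGenerationsFire`; backward: `exists_livePumpCascade_of_clockedInstants`. HONEST FRAMING: an
equivalence of two uninhabited-as-far-as-known statements; NOT a claim that NS blows up. -/
theorem live_calibration (S : CascadeSpecs) (hα : 0 < S.alpha) (hη : 1 / 4 < S.eta)
    (u₀ : 𝓢(EuclideanSpace ℝ (Fin 3), EuclideanSpace ℝ (Fin 3)))
    (hdiv : VectorCalculus.IsDivFree ⇑u₀) :
    (∃ L : PumpCascade S, L.u₀ = u₀ ∧ L.Live) ↔
      ∃ (Sm : ℝ) (U : ℝ → L2C) (t : ℕ → ℝ),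
        IsMildSolutionFor eulerForm (schwartzL2 u₀) (Ico 0 Sm) U ∧
          t 0 = 0 ∧ Monotone t ∧ (∀ n, t n < Sm) ∧ (∀ n, t (n + 1) - t n ≤ S.Tmax n) ∧
            ∀ n, ENNReal.ofReal (S.Emin n) ≤ highFreqEnergy (S.lam n) (U (t n)) := by
  constructor
  · rintro ⟨L, rfl, hlive⟩
    obtain ⟨Sm, -, -, U, hU, -, -, t, ht0, htmono, htlt, htstep, hmem⟩ :=
      allGenerationsFire L hα hη hlive
    exact ⟨Sm, U, t, hU, ht0, htmono, htlt, fun n => (htstep n).trans (L.time n),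
      fun n => floor_of_mem L n (hmem n)⟩
  · rintro ⟨Sm, U, t, hU, ht0, htmono, htlt, htime, hfloor⟩
    obtain ⟨L, hL, hlive, -⟩ :=
      exists_livePumpCascade_of_clockedInstants S u₀ hdiv hU t ht0 htmono htlt htime hfloor
    exact ⟨L, hL, hlive⟩


end Summit.NavierStokesRegularity.NavierStokesRegularity.Theorems.FluidComputer

end
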